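import Summits.AtomisticToContinuum.FouriersLaw.Theorems.EmbeddedDrudeMourreDrudeDissolutionStubWickShellStaticPattern
import Summits.AtomisticToContinuum.FouriersLaw.Theorems.EmbeddedDrudeMourreDrudeDissolutionStubWickShellDynamicChaos
import HarnessLib

/-!
# Stub K2 `stub_wickShellStatic`, part V: summing the patterns — from the lattice sum to the chaos inner product
(line `gram-pencil-harmonic-chaos`, crux `EmbeddedDrudeMourre.DrudeDissolution`,
item stmt-AtomisticToContinuum-12593; `--supports` file, closes nothing; lead c11)

WHAT. (F1) For Wick monomial data `f, g : Fin N → TestFn` the lattice series `Σ_y Π_i C₁(f_i, τ_y g_i)` converges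
and equals the sum over creation patterns `S ⊆ Fin N` of big-shell integrals (two-point function = annihilation +
creation Fourier coefficient, `Finset.prod_add`, lattice Parseval in big-shell form as hypothesis `hP`);
(F2) summed over the relabellings `ρ` of `f` and `π` of `g` this is `Σ_S |S|! |Sᶜ|! ⟪wickVector f s_S, wickVector g s_S⟫`
(`pattern_integral_eq`, `sum_sum_pattern_integral_eq_inner`); (F3) regrouping by `|S|` and `C(N,m) m! (N−m)! = N!`
gives `N! · ⟪wickVector f, wickVector g⟫` (the `lp` inner product is the sum over the sectors `(m, N − m)`).
-/

noncomputable section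

namespace Summit.AtomisticToContinuum.FouriersLaw.Theorems.DrudeDissolution.GramPencilHarmonicChaos

open MeasureTheory Filter Set Function Topology
open scoped InnerProductSpace ENNReal ComplexConjugate
open Literature.MathematicalPhysics.KineticTheory
open Literature.MathematicalPhysics.KineticTheory.HeatConduction
open HarmonicChaos ProbabilityTheory
open PinnedChainKinetic (𝕋 𝕋3 μ𝕋 μ𝕋3)
open scoped Literature.MathematicalPhysics.KineticTheory.HeatConduction.PinnedChainKinetic

/-! ## (F1) the lattice sum of a product of shifted two-point functions -/

/-- **(F1)** For `f, g : Fin N → TestFn`, assuming lattice Parseval in big-shell form for `N` factors, the series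
`Σ_y Π_i C_T(f_i, τ_y g_i)` converges (in `ℂ`) to the sum over creation patterns `S` of the big-shell integrals of
the pattern products of pair amplitudes. [folklore] -/
theorem hasSum_prod_thermalCov_shift {ω₂ : ℝ} (hω : 0 < ω₂) {T : ℝ} (hT : 0 ≤ T) {N : ℕ}
    (hP : ∀ B : Fin N → 𝕋 → ℂ, (∀ x, Continuous (B x)) →
      HasSum (fun y : ℤ => ∏ x, fourierCoeff (B x) y)
        (∫ κ : Shell N 0, ∏ x, B x ((κ : SectorConfig N 0).1 x) ∂shellMeasure N 0))
    (f g : Fin N → TestFn) :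
    HasSum (fun y : ℤ => (((∏ i, thermalCov ω₂ T (f i)
        (Finsupp.mapDomain (fun x : ℤ => x + y) (g i).1, Finsupp.mapDomain (fun x : ℤ => x + y) (g i).2)) : ℝ) : ℂ))
      (∑ S ∈ (Finset.univ : Finset (Fin N)).powerset,
        ∫ κ : Shell N 0, ∏ x, (if x ∈ S then
          (fun k : 𝕋 => conj (conj (thermalWave ω₂ T (f x) (-k)) * thermalWave ω₂ T (g x) (-k)))
          else (fun k : 𝕋 => conj (thermalWave ω₂ T (f x) k) * thermalWave ω₂ T (g x) k))
            ((κ : SectorConfig N 0).1 x) ∂shellMeasure N 0) := by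
  classical
  -- the two channels
  set A : Fin N → 𝕋 → ℂ := fun x k => conj (thermalWave ω₂ T (f x) k) * thermalWave ω₂ T (g x) k with hA
  set A' : Fin N → 𝕋 → ℂ := fun x k => conj (conj (thermalWave ω₂ T (f x) (-k)) * thermalWave ω₂ T (g x) (-k))
    with hA'
  have hAc : ∀ x, Continuous (A x) := fun x => continuous_pairAmp hω T (f x) (g x)
  have hA'c : ∀ x, Continuous (A' x) := fun x =>
    Complex.continuous_conj.comp ((continuous_pairAmp hω T (f x) (g x)).comp continuous_neg)
  -- rewrite the general term as a sum over patterns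
  have hterm : ∀ y : ℤ, (((∏ i, thermalCov ω₂ T (f i)
      (Finsupp.mapDomain (fun x : ℤ => x + y) (g i).1, Finsupp.mapDomain (fun x : ℤ => x + y) (g i).2)) : ℝ) : ℂ) =
      ∑ S ∈ (Finset.univ : Finset (Fin N)).powerset, ∏ x, fourierCoeff (S.piecewise A' A x) (-y) := by
    intro y
    push_cast
    have h1 : ∀ i, ((thermalCov ω₂ T (f i)
        (Finsupp.mapDomain (fun x : ℤ => x + y) (g i).1, Finsupp.mapDomain (fun x : ℤ => x + y) (g i).2) : ℝ) : ℂ) =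
        fourierCoeff (A' i) (-y) + fourierCoeff (A i) (-y) := fun i => by
      rw [thermalCov_shift_eq_fourierCoeff_add hω hT, add_comm]
    simp_rw [h1]
    rw [Finset.prod_add]
    refine Finset.sum_congr rfl fun S _ => ?_
    rw [show (∏ x, fourierCoeff (S.piecewise A' A x) (-y)) =
        ∏ x, S.piecewise (fun i => fourierCoeff (A' i) (-y)) (fun i => fourierCoeff (A i) (-y)) x from
      Finset.prod_congr rfl (fun x _ => by simp only [Finset.piecewise]; split_ifs <;> rfl),
      Finset.prod_piecewise, Finset.univ_inter]
  simp_rw [hterm]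
  refine hasSum_sum fun S _ => ?_
  -- Parseval for the pattern `S`, reindexed along `y ↦ −y`
  have hBS : ∀ x, Continuous (S.piecewise A' A x) := fun x => by
    simp only [Finset.piecewise]
    split_ifs
    · exact hA'c x
    · exact hAc x
  have h := hP (S.piecewise A' A) hBS
  rw [← Equiv.hasSum_iff (Equiv.neg ℤ)] at h
  convert h using 2 with y
  · simp only [Function.comp_apply, Equiv.neg_apply]
  · funext κ
    refine Finset.prod_congr rfl fun x _ => ?_
    simp only [Finset.piecewise, hA, hA']

/-! ## (F2) summing over the relabellings -/

/-- **(F2)** Summed over the relabellings `ρ` of `f`'s slots and `π` of `g`'s slots, the lattice series of (F1)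
becomes the pattern sum of symmetrised sector inner products `Σ_S |S|! |Sᶜ|! ⟪wickVector f s_S, wickVector g s_S⟫`.
[cite: Janson1997, Thm 3.9] -/
theorem sum_sum_tsum_prod_thermalCov_shift {ω₂ : ℝ} (hω : 0 < ω₂) {T : ℝ} (hT : 0 ≤ T) {N : ℕ} (hN : N ≠ 0)
    (hP : ∀ B : Fin N → 𝕋 → ℂ, (∀ x, Continuous (B x)) →
      HasSum (fun y : ℤ => ∏ x, fourierCoeff (B x) y)
        (∫ κ : Shell N 0, ∏ x, B x ((κ : SectorConfig N 0).1 x) ∂shellMeasure N 0))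
    (f g : Fin N → TestFn) :
    ∑ ρ : Equiv.Perm (Fin N), ∑ π : Equiv.Perm (Fin N), ∑' y : ℤ, (((∏ i, thermalCov ω₂ T (f (ρ i))
        (Finsupp.mapDomain (fun x : ℤ => x + y) (g (π i)).1, Finsupp.mapDomain (fun x : ℤ => x + y) (g (π i)).2)) : ℝ) : ℂ) =
      ∑ S ∈ (Finset.univ : Finset (Fin N)).powerset,
        if h : (S.card, Sᶜ.card) ≠ (0, 0) then
          ((S.card.factorial * Sᶜ.card.factorial : ℕ) : ℂ) *
            ⟪wickVector ω₂ T f (SectorIndex.mk S.card Sᶜ.card h), wickVector ω₂ T g (SectorIndex.mk S.card Sᶜ.card h)⟫_ℂ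
        else 0 := by
  classical
  -- (F1) for each pair of relabellings
  have hF1 : ∀ ρ π : Equiv.Perm (Fin N), ∑' y : ℤ, (((∏ i, thermalCov ω₂ T (f (ρ i))
      (Finsupp.mapDomain (fun x : ℤ => x + y) (g (π i)).1, Finsupp.mapDomain (fun x : ℤ => x + y) (g (π i)).2)) : ℝ) : ℂ) =
      ∑ S ∈ (Finset.univ : Finset (Fin N)).powerset,
        ∫ κ : Shell N 0, ∏ x, (if x ∈ S then
          (fun k : 𝕋 => conj (conj (thermalWave ω₂ T (f (ρ x)) (-k)) * thermalWave ω₂ T (g (π x)) (-k)))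
          else (fun k : 𝕋 => conj (thermalWave ω₂ T (f (ρ x)) k) * thermalWave ω₂ T (g (π x)) k))
            ((κ : SectorConfig N 0).1 x) ∂shellMeasure N 0 :=
    fun ρ π => (hasSum_prod_thermalCov_shift hω hT hP (f ∘ ρ) (g ∘ π)).tsum_eq
  simp_rw [hF1]
  simp_rw [Finset.sum_comm (s := (Finset.univ : Finset (Equiv.Perm (Fin N))))
    (t := (Finset.univ : Finset (Fin N)).powerset)]
  refine Finset.sum_congr rfl fun S _ => ?_
  have hcard : S.card + Sᶜ.card = N := by
    rw [Finset.card_compl, Fintype.card_fin]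
    have := S.card_le_univ
    rw [Fintype.card_fin] at this
    omega
  have hne : (S.card, Sᶜ.card) ≠ (0, 0) := by
    intro h
    simp only [Prod.mk.injEq] at h
    omega
  rw [dif_pos hne]
  obtain ⟨e, hl, hr⟩ := exists_sum_equiv_of_card S rfl rfl
  have hpat : ∀ ρ π : Equiv.Perm (Fin N),
      ∫ κ : Shell N 0, ∏ x, (if x ∈ S then
          (fun k : 𝕋 => conj (conj (thermalWave ω₂ T (f (ρ x)) (-k)) * thermalWave ω₂ T (g (π x)) (-k)))
          else (fun k : 𝕋 => conj (thermalWave ω₂ T (f (ρ x)) k) * thermalWave ω₂ T (g (π x)) k))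
            ((κ : SectorConfig N 0).1 x) ∂shellMeasure N 0 =
      ∫ κ : Shell S.card Sᶜ.card,
        conj ((∏ i : Fin S.card, conj (thermalWave ω₂ T (f (ρ (e (Sum.inl i)))) ((κ : SectorConfig S.card Sᶜ.card).1 i))) *
            ∏ j : Fin Sᶜ.card, thermalWave ω₂ T (f (ρ (e (Sum.inr j)))) ((κ : SectorConfig S.card Sᶜ.card).2 j)) *
          ((∏ i : Fin S.card, conj (thermalWave ω₂ T (g (π (e (Sum.inl i)))) ((κ : SectorConfig S.card Sᶜ.card).1 i))) *
            ∏ j : Fin Sᶜ.card, thermalWave ω₂ T (g (π (e (Sum.inr j)))) ((κ : SectorConfig S.card Sᶜ.card).2 j))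
              ∂shellMeasure S.card Sᶜ.card :=
    fun ρ π => pattern_integral_eq hω T (f ∘ ρ) (g ∘ π) S e hl hr
  simp_rw [hpat]
  exact sum_sum_pattern_integral_eq_inner hω T hne f g e

/-! ## (F3) regrouping by the number of created phonons -/

/-- **(F3)** `Σ_{S ⊆ Fin N} |S|! |Sᶜ|! ⟪wickVector f s_S, wickVector g s_S⟫ = N! ⟪wickVector f, wickVector g⟫`
(`N ≥ 1`). [folklore] -/
theorem sum_powerset_inner_eq {ω₂ T : ℝ} {N : ℕ} (hN : N ≠ 0) (f g : Fin N → TestFn) :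
    (∑ S ∈ (Finset.univ : Finset (Fin N)).powerset,
        if h : (S.card, Sᶜ.card) ≠ (0, 0) then
          ((S.card.factorial * Sᶜ.card.factorial : ℕ) : ℂ) *
            ⟪wickVector ω₂ T f (SectorIndex.mk S.card Sᶜ.card h), wickVector ω₂ T g (SectorIndex.mk S.card Sᶜ.card h)⟫_ℂ
        else 0) =
      ((N.factorial : ℕ) : ℂ) * ⟪wickVector ω₂ T f, wickVector ω₂ T g⟫_ℂ := by
  classical
  -- the term only depends on the cardinality
  set φ : ℕ → ℂ := fun m =>
    if h : (m, N - m) ≠ (0, 0) then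
      ((m.factorial * (N - m).factorial : ℕ) : ℂ) *
        ⟪wickVector ω₂ T f (SectorIndex.mk m (N - m) h), wickVector ω₂ T g (SectorIndex.mk m (N - m) h)⟫_ℂ
    else 0 with hφ
  have hcc : ∀ S : Finset (Fin N), Sᶜ.card = N - S.card := fun S => by
    rw [Finset.card_compl, Fintype.card_fin]
  have hS : ∀ S ∈ (Finset.univ : Finset (Fin N)).powerset,
      (if h : (S.card, Sᶜ.card) ≠ (0, 0) then
          ((S.card.factorial * Sᶜ.card.factorial : ℕ) : ℂ) *
            ⟪wickVector ω₂ T f (SectorIndex.mk S.card Sᶜ.card h), wickVector ω₂ T g (SectorIndex.mk S.card Sᶜ.card h)⟫_ℂ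
        else 0) = φ S.card := by
    intro S _
    rw [hφ]
    simp only
    have key : ∀ (n : ℕ) (hn : n = N - S.card),
        (if h : (S.card, n) ≠ (0, 0) then
          ((S.card.factorial * n.factorial : ℕ) : ℂ) *
            ⟪wickVector ω₂ T f (SectorIndex.mk S.card n h), wickVector ω₂ T g (SectorIndex.mk S.card n h)⟫_ℂ
        else 0) =
        (if h : (S.card, N - S.card) ≠ (0, 0) then
          ((S.card.factorial * (N - S.card).factorial : ℕ) : ℂ) *
            ⟪wickVector ω₂ T f (SectorIndex.mk S.card (N - S.card) h),
              wickVector ω₂ T g (SectorIndex.mk S.card (N - S.card) h)⟫_ℂ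
        else 0) := by
      intro n hn
      subst hn
      rfl
    exact key _ (hcc S)
  rw [Finset.sum_congr rfl hS, Finset.sum_powerset, Finset.card_univ, Fintype.card_fin]
  simp_rw [Finset.sum_powersetCard, Finset.card_univ, Fintype.card_fin]
  -- the sectors `(m, N - m)`
  have hι : ∀ m : ℕ, (m, N - m) ≠ (0, 0) := by
    intro m h
    simp only [Prod.mk.injEq] at h
    omega
  set ι : ℕ → SectorIndex := fun m => SectorIndex.mk m (N - m) (hι m) with hιdef
  have hφψ : ∀ m ∈ Finset.range (N + 1), (N.choose m) • φ m =
      ((N.factorial : ℕ) : ℂ) * ⟪wickVector ω₂ T f (ι m), wickVector ω₂ T g (ι m)⟫_ℂ := by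
    intro m hm
    rw [Finset.mem_range] at hm
    rw [hφ]
    simp only
    rw [dif_pos (hι m), nsmul_eq_mul, ← mul_assoc, ← Nat.cast_mul,
      show N.choose m * (m.factorial * (N - m).factorial) = N.factorial by
        rw [← mul_assoc]; exact Nat.choose_mul_factorial_mul_factorial (by omega)]
  rw [Finset.sum_congr rfl hφψ, ← Finset.mul_sum]
  congr 1
  -- the `lp` inner product is the sum over the sectors `(m, N - m)`
  rw [lp.inner_eq_tsum]
  have hzero : ∀ s : SectorIndex, s ∉ (Finset.range (N + 1)).image ι →
      ⟪wickVector ω₂ T f s, wickVector ω₂ T g s⟫_ℂ = 0 := by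
    intro s hs
    by_cases hsum : s.cr + s.an = N
    · exfalso
      apply hs
      rw [Finset.mem_image]
      refine ⟨s.cr, Finset.mem_range.2 (by omega), ?_⟩
      rw [hιdef]
      apply Subtype.ext
      simp only
      ext
      · rfl
      · show N - s.cr = s.an
        omega
    · rw [wickVector_apply_of_ne ω₂ T f hsum, inner_zero_left]
  rw [tsum_eq_sum (s := (Finset.range (N + 1)).image ι) (fun s hs => hzero s hs)]
  rw [Finset.sum_image]
  intro m _ m' _ h
  rw [hιdef] at h
  have := congrArg (fun s : SectorIndex => s.cr) h
  exact this

end Summit.AtomisticToContinuum.FouriersLaw.Theorems.DrudeDissolution.GramPencilHarmonicChaos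

end
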